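import Summits.BirchSwinnertonDyer.BirchSwinnertonDyer.Theorems.GoldfeldAllTwistsTwoConverseTwinSplitSecondHalvingAlgebra
import Summits.BirchSwinnertonDyer.BirchSwinnertonDyer.Theorems.GoldfeldAllTwistsTwoConverseTwinGenusExplicitClassKolyvagin
import Literature.NumberTheory.EllipticCurves.RingClassFieldGenusProofs
import HarnessLib

set_option linter.dupNamespace false -- `…BirchSwinnertonDyer.BirchSwinnertonDyer…` is the cell's namespace (D-0017)
set_option autoImplicit false

/-!
# Twin″ (item 19140), LINE U″ — the closing `2`-descent coordinates, II (file C of A → C → F): the `x`-square classes of the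
# generators of `49a1^{(−ℓ)}(ℚ)` and `49a1^{(−a)}(ℚ)`, the small inputs over `H = K[1]`, and the torsion / transport bookkeeping

Cell `bsd-goldfeld`, seat `bsd-goldfeld-s1p-c301` (prover; gen 15 draft, gen 16 filing on planner ORDER (ccxxx)/(ccxxxv)/(ccxxxvii) «LINE U″»;
this is the announced forced mechanical split between A = `…TwinSplitSecondHalvingAlgebra` and F = `…TwinSplitSecondHalvingFinal`).
Support for `stmt-BirchSwinnertonDyer-19140` (twin″); Theses-free; theorems only; no `sorry`, no definition, no instance, no new named fact
(§2's first lemma merely re-types U2d `isSquare_prod_filter_ringClassGal` at level `M = 49` and carries U2d's two print binders `hEta`, `hD`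
by name). HONEST FRAMING: elementary; nothing about `L`-values; no case of twin″ or of BSD is decided here.

* §0 `of_decEq_indep[₂]` — the device behind every «world crossing» below and in F: a statement about points of Weierstrass curves that
  holds for one equality-decision procedure on the field holds for every other (`Subsingleton (DecidableEq F)`); the tree's point-group
  lemmas come in three decidability worlds (`instDecidableEqRat`, the subtype instance of `K[1] ⊂ ℂ`, the classical one of the generic-field
  Literature lemmas / `twistPointEquivOver` / `QuadraticDescent.incl`); nothing mathematical happens in a crossing.
* §1 **`isSquare_generator_negSplitPrime_of_symbol_neg`** (`σ(ℓ) = −1`: a generator `g = (x, ·)` of `E_{−ℓ}(ℚ) = [0,−21ℓ,0,112ℓ²,0](ℚ)`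
  modulo torsion has `2ℓ·x ∈ ℚ²` or `14ℓ·x ∈ ℚ²`) and **`isSquare_generator_negInertPrime`** (inert `a ≡ 1 (mod 4)`: `2x` or `14x ∈ ℚ²`),
  from A + VIII / c301 gen 6, 13; and the same on generators `(X, ·)` of the TWIST models `X₀(49)^{(−ℓ)}(ℚ)`, `X₀(49)^{(−a)}(ℚ)`
  (`x = 4(X + 2ℓ)`, resp. `4(X + 2a)`), stated for an ARBITRARY decidability instance on `ℚ` (`…_quadraticTwist_…`).
* §2 inputs over `H`: U2d at level `49`; `±7 ∉ K[1]²` (`7 ∤ d_K`); on `X₀(49)`, `x = 2 ⟹ y = −1` and `(2, −1)` is `2`-torsion.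
* §3 (classical world of `twistPointEquivOver` / `incl` / Mordell–Weil): finite order is reflected along `ι` and `Φ_u ∘ ι`;
  `Φ_u(ι(k·g + t)) = k·Φ_u(ι g) + Φ_u(ι t)`; rank-one bookkeeping `z = N₀·g + t₀`, `[V(ℚ):ℤz] = 2|N₀|`.
References: [SilvermanTate2015] §3.5–3.6; [SilvermanAEC2009] VIII.6, X.4.9; [Gross1984] §I.1; [Cox2013] §9.A.
-/

noncomputable section

open scoped Classical

open NumberField WeierstrassCurve Field Literature.NumberTheory Literature.NumberTheory.EllipticCurves
  Literature.NumberTheory.EllipticCurves.ModularForms Literature.NumberTheory.EllipticCurves.CaiShuTian2014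
  Literature.NumberTheory.GaloisRepresentations
  Summit.BirchSwinnertonDyer.Rank1Residual.AdditivePotMult
open WeierstrassCurve.Affine (sqClass sqClass_mul sqClass_sq sqClass_eq_one_iff)

namespace Summit.BirchSwinnertonDyer.BirchSwinnertonDyer.Theorems.GoldfeldGoodTwists

/-! ## §0 World crossing -/

/-- **Decidability-world transfer.** A property of an equality-decision procedure on `F` that holds for one holds for all
(`DecidableEq F` is a subsingleton). Used with `P := fun d ↦ <a statement about `W(F)` whose group law is built from d>`. [folklore] -/
theorem of_decEq_indep {F : Type*} (P : DecidableEq F → Prop) {d₁ : DecidableEq F} (d₂ : DecidableEq F) (h : P d₁) : P d₂ := by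
  obtain rfl : d₁ = d₂ := Subsingleton.elim _ _
  exact h

/-- `of_decEq_indep` for two fields at once (statements mixing `W(ℚ)` and `W(K[1])`). [folklore] -/
theorem of_decEq_indep₂ {F F' : Type*} (P : DecidableEq F → DecidableEq F' → Prop) {d₁ : DecidableEq F} {d₁' : DecidableEq F'}
    (d₂ : DecidableEq F) (d₂' : DecidableEq F') (h : P d₁ d₁') : P d₂ d₂' := by
  obtain rfl : d₁ = d₂ := Subsingleton.elim _ _
  obtain rfl : d₁' = d₂' := Subsingleton.elim _ _
  exact h

/-! ## §1 The `x`-square class of a generator: `49a1^{(−ℓ)}` (`σ(ℓ) = −1`) and `49a1^{(−a)}` (`a` inert) -/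

section Instances

variable {l : ℕ} [Fact l.Prime]

/-- **`σ(ℓ) = −1`: the `x`-class of a generator is `[2ℓ]` or `[14ℓ]`.** For `ℓ ≡ 5 (mod 8)` prime, `(−7/ℓ) = +1`, `σ(ℓ) = −1`, and
`E_{−ℓ} = [0, −21ℓ, 0, 112ℓ², 0]` of rank one: a generator `g = (x, y)` modulo torsion has **`2ℓ·x ∈ ℚ²` or `14ℓ·x ∈ ℚ²`** — `α(g) = [d]`,
`d ∈ S(−ℓ) ⊆ {1,7,ℓ,2ℓ,7ℓ,14ℓ}` (§3), `d ∉ {ℓ, 7ℓ}` (c301 gen 13 `ell_classes_not_mem_selmer_negTwist_of_symbol_neg`), `[d] ∉ {1, [7]}` (§2).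
[cite: SilvermanTate2015, §3.5–3.6] [cite: SilvermanAEC2009, Prop. X.4.9] -/
theorem isSquare_generator_negSplitPrime_of_symbol_neg (hl8 : l % 8 = 5) (hl7 : legendreSym l (-7) = 1)
    (hσ : ∀ s : ZMod l, s ^ 2 = -7 → ¬ IsSquare (2 * (s - 21)))
    [hE : (⟨0, ((21 * (-(l : ℤ)) : ℤ) : ℚ), 0, ((112 * (-(l : ℤ)) ^ 2 : ℤ) : ℚ), 0⟩ : WeierstrassCurve ℚ).IsElliptic]
    (hr : (⟨0, ((21 * (-(l : ℤ)) : ℤ) : ℚ), 0, ((112 * (-(l : ℤ)) ^ 2 : ℤ) : ℚ), 0⟩ : WeierstrassCurve ℚ).mordellWeilRank = 1)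
    {x y : ℚ} (hg : (⟨0, ((21 * (-(l : ℤ)) : ℤ) : ℚ), 0, ((112 * (-(l : ℤ)) ^ 2 : ℤ) : ℚ), 0⟩ : WeierstrassCurve ℚ).toAffine.Nonsingular x y)
    (hgen : ∀ P : (⟨0, ((21 * (-(l : ℤ)) : ℤ) : ℚ), 0, ((112 * (-(l : ℤ)) ^ 2 : ℤ) : ℚ), 0⟩ : WeierstrassCurve ℚ).toAffine.Point,
      ∃ (k : ℤ) (t : (⟨0, ((21 * (-(l : ℤ)) : ℤ) : ℚ), 0, ((112 * (-(l : ℤ)) ^ 2 : ℤ) : ℚ), 0⟩ : WeierstrassCurve ℚ).toAffine.Point),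
        IsOfFinAddOrder t ∧ P = k • Affine.Point.some x y hg + t) :
    IsSquare (2 * (l : ℚ) * x) ∨ IsSquare (14 * (l : ℚ) * x) := by
  have hl : l.Prime := Fact.out
  obtain ⟨hl2, hl7ne, hl4⟩ := prime_ne_two_ne_seven_of_mod_eight_five hl8
  have hl0 : (l : ℚ) ≠ 0 := by exact_mod_cast hl.ne_zero
  -- casts: the model is `E_{a,b}` with `a = −21ℓ`, `b = 112ℓ²`
  have ea : ((21 * (-(l : ℤ)) : ℤ) : ℚ) = ((-21 * (l : ℤ) : ℤ) : ℚ) := by push_cast; ring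
  have eb : ((112 * (-(l : ℤ)) ^ 2 : ℤ) : ℚ) = ((112 * (l : ℤ) ^ 2 : ℤ) : ℚ) := by push_cast; ring
  have hab : (112 * (l : ℤ) ^ 2) * ((-21 * (l : ℤ)) ^ 2 - 4 * (112 * (l : ℤ) ^ 2)) ≠ 0 := by
    rw [show ((-21 * (l : ℤ)) ^ 2 - 4 * (112 * (l : ℤ) ^ 2)) = -7 * l ^ 2 by ring]
    exact mul_ne_zero (mul_ne_zero (by norm_num) (pow_ne_zero 2 (by exact_mod_cast hl.ne_zero)))
      (mul_ne_zero (by norm_num) (pow_ne_zero 2 (by exact_mod_cast hl.ne_zero)))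
  have hsq : Squarefree (-(l : ℤ)) := ((Nat.prime_iff_prime_int.mp hl).neg).irreducible.squarefree
  have htors := torsion_twoTorsionModel_cm7 (M := -(l : ℤ)) hsq (by omega)
    (fun h ↦ hl7ne ((Nat.prime_dvd_prime_iff_eq (by norm_num) hl).mp (by exact_mod_cast dvd_neg.mp h)).symm)
  -- move to the literal `E_{−21ℓ, 112ℓ²}`
  revert hE hr hg hgen htors
  rw [ea, eb]
  intro hE hr hg hgen htors
  have hS' : (twoIsogenySelmerGroup' (-21 * (l : ℤ)) (112 * (l : ℤ) ^ 2)).card ≤ 2 :=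
    card_twoIsogenySelmerGroup'_splitPrimeTwist_le hl8 hl7
  obtain ⟨hne1, hneb⟩ := xSqClass_generator_ne hab hr htors hS' hgen
  -- `α(g) = [x] = [d]`, `d ∈ S(−ℓ)`
  have hx0 : x ≠ 0 := by
    intro h0
    subst h0
    exact hneb (by rw [xSqClass_some_of_eq_zero _ rfl])
  rw [xSqClass_some_of_ne_zero _ hx0] at hne1 hneb
  obtain ⟨d, hdS, hd⟩ : ∃ d ∈ twoIsogenySelmerGroup (-21 * (l : ℤ)) (112 * (l : ℤ) ^ 2), sqClass (d : ℚ) = sqClass x := by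
    have hmem := range_xSqClass_subset_image_twoIsogenySelmerGroup hab ⟨Affine.Point.some x y hg, rfl⟩
    rw [Finset.coe_image, xSqClass_some_of_ne_zero _ hx0] at hmem
    obtain ⟨d, hd, hde⟩ := hmem
    exact ⟨d, hd, hde⟩
  have hd0 : (d : ℚ) ≠ 0 := by exact_mod_cast ne_zero_of_mem_twoIsogenySelmerGroup hdS
  have hdx : IsSquare ((d : ℚ) * x) := by
    obtain ⟨u, hu⟩ := (sqClass_eq_one_iff (mul_ne_zero hd0 hx0)).mp (by rw [sqClass_mul hd0 hx0, hd, Affine.SqUnits.mul_self])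
    exact ⟨u, by rw [hu, pow_two]⟩
  -- the value of `d`
  obtain ⟨s, t, hs, ht⟩ := exists_sq_eq_neg_seven_and_sq_eq_seven hl4 hl7
  obtain ⟨hdl, hd7l⟩ := ell_classes_not_mem_selmer_negTwist_of_symbol_neg hl2 hl7ne hs ht (hσ s hs)
  have hd1 : d ≠ 1 := by
    rintro rfl
    exact hne1 (by rw [← hd]; push_cast; simpa using sqClass_sq (1 : ℚ))
  have hd7 : d ≠ 7 := by
    rintro rfl
    apply hneb
    rw [← hd]
    have : ((112 * (l : ℤ) ^ 2 : ℤ) : ℚ) = 7 * (4 * (l : ℚ)) ^ 2 := by push_cast; ring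
    rw [this, sqClass_mul (by norm_num) (pow_ne_zero _ (mul_ne_zero (by norm_num) hl0)), sqClass_sq, Affine.SqUnits.mul_one]
    norm_num
  have hmem := twoIsogenySelmerGroup_negSplitPrime_subset hl8 hl7 hdS
  simp only [Finset.mem_insert, Finset.mem_singleton, mul_one] at hmem
  rcases hmem with rfl | rfl | rfl | rfl | rfl | rfl
  · exact absurd rfl hd1
  · exact absurd rfl hd7
  · exact absurd hdS hdl
  · left; convert hdx using 2; push_cast; ring
  · rw [mul_comm (l : ℤ) 7] at hdS; exact absurd hdS hd7l
  · right; convert hdx using 2; push_cast; ring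

/-- **Inert `a`: the `x`-class of a generator is `[2]` or `[14]`.** For a prime `a ≡ 1 (mod 4)` inert in `ℚ(√−7)` and
`E_{−a} = [0, −21a, 0, 112a², 0]` of rank one: a generator `g = (x, y)` modulo torsion has **`2x ∈ ℚ²` or `14x ∈ ℚ²`** — `d ∈ S(−a) ⊆ {1,2,7,14}`,
`S′(−a) ⊆ {1, −7}` (c301 gen 6 `mem_of_mem_twoIsogenySelmerGroup[']_inertTwist`), `[d] ∉ {1,[7]}` (§2). [cite: SilvermanTate2015, §3.5–3.6]
[cite: SilvermanAEC2009, Prop. X.4.9] -/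
theorem isSquare_generator_negInertPrime {a : ℕ} (ha : a.Prime) (ha4 : a % 4 = 1) (ha7 : jacobiSym (-7) a = -1)
    [hE : (⟨0, ((21 * (-(a : ℤ)) : ℤ) : ℚ), 0, ((112 * (-(a : ℤ)) ^ 2 : ℤ) : ℚ), 0⟩ : WeierstrassCurve ℚ).IsElliptic]
    (hr : (⟨0, ((21 * (-(a : ℤ)) : ℤ) : ℚ), 0, ((112 * (-(a : ℤ)) ^ 2 : ℤ) : ℚ), 0⟩ : WeierstrassCurve ℚ).mordellWeilRank = 1)
    {x y : ℚ} (hg : (⟨0, ((21 * (-(a : ℤ)) : ℤ) : ℚ), 0, ((112 * (-(a : ℤ)) ^ 2 : ℤ) : ℚ), 0⟩ : WeierstrassCurve ℚ).toAffine.Nonsingular x y)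
    (hgen : ∀ P : (⟨0, ((21 * (-(a : ℤ)) : ℤ) : ℚ), 0, ((112 * (-(a : ℤ)) ^ 2 : ℤ) : ℚ), 0⟩ : WeierstrassCurve ℚ).toAffine.Point,
      ∃ (k : ℤ) (t : (⟨0, ((21 * (-(a : ℤ)) : ℤ) : ℚ), 0, ((112 * (-(a : ℤ)) ^ 2 : ℤ) : ℚ), 0⟩ : WeierstrassCurve ℚ).toAffine.Point),
        IsOfFinAddOrder t ∧ P = k • Affine.Point.some x y hg + t) :
    IsSquare (2 * x) ∨ IsSquare (14 * x) := by
  have ha0 : (a : ℚ) ≠ 0 := by exact_mod_cast ha.ne_zero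
  have ha7j : jacobiSym (a : ℤ) 7 = -1 := by rw [jacobiSym_seven_eq_jacobiSym_neg_seven_of_one_mod_four ha4, ha7]
  obtain ⟨ha2, ha7ne⟩ := ne_two_and_ne_seven_of_jacobiSym ha7j
  haveI : Fact a.Prime := ⟨ha⟩
  have hns : ¬ IsSquare ((-7 : ℤ) : ZMod a) := by
    rw [← legendreSym.eq_neg_one_iff (p := a), jacobiSym.legendreSym.to_jacobiSym]; exact ha7
  have ea : ((21 * (-(a : ℤ)) : ℤ) : ℚ) = ((-21 * (a : ℕ) : ℤ) : ℚ) := by push_cast; ring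
  have eb : ((112 * (-(a : ℤ)) ^ 2 : ℤ) : ℚ) = ((112 * (a : ℕ) ^ 2 : ℤ) : ℚ) := by push_cast; ring
  have hab : (112 * (a : ℤ) ^ 2) * ((-21 * (a : ℤ)) ^ 2 - 4 * (112 * (a : ℤ) ^ 2)) ≠ 0 := by
    rw [show ((-21 * (a : ℤ)) ^ 2 - 4 * (112 * (a : ℤ) ^ 2)) = -7 * a ^ 2 by ring]
    exact mul_ne_zero (mul_ne_zero (by norm_num) (pow_ne_zero 2 (by exact_mod_cast ha.ne_zero)))
      (mul_ne_zero (by norm_num) (pow_ne_zero 2 (by exact_mod_cast ha.ne_zero)))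
  have hsq : Squarefree (-(a : ℤ)) := ((Nat.prime_iff_prime_int.mp ha).neg).irreducible.squarefree
  have htors := torsion_twoTorsionModel_cm7 (M := -(a : ℤ)) hsq (by omega)
    (fun h ↦ ha7ne ((Nat.prime_dvd_prime_iff_eq (by norm_num) ha).mp (by exact_mod_cast dvd_neg.mp h)).symm)
  revert hE hr hg hgen htors
  rw [ea, eb]
  intro hE hr hg hgen htors
  have hinert : ∀ q : ℕ, q.Prime → q ∣ a → ¬ IsSquare ((-7 : ℤ) : ZMod q) := fun q hq hqa ↦ by
    rw [(Nat.prime_dvd_prime_iff_eq hq ha).mp hqa]; exact hns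
  have hinert' : ∀ q : ℕ, q.Prime → q ∣ a → q % 4 = 1 ∧ ¬ IsSquare ((-7 : ℤ) : ZMod q) := fun q hq hqa ↦ by
    rw [(Nat.prime_dvd_prime_iff_eq hq ha).mp hqa]; exact ⟨ha4, hns⟩
  have hS' : (twoIsogenySelmerGroup' (-21 * (a : ℕ)) (112 * (a : ℕ) ^ 2)).card ≤ 2 := by
    calc (twoIsogenySelmerGroup' (-21 * (a : ℕ)) (112 * (a : ℕ) ^ 2)).card ≤ ({1, -7} : Finset ℤ).card :=
          Finset.card_le_card fun d hd ↦ mem_of_mem_twoIsogenySelmerGroup'_inertTwist ha.pos ha.squarefree hinert' hd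
      _ ≤ 2 := Finset.card_le_two
  obtain ⟨hne1, hneb⟩ := xSqClass_generator_ne hab hr htors hS' hgen
  have hx0 : x ≠ 0 := by
    intro h0
    subst h0
    exact hneb (by rw [xSqClass_some_of_eq_zero _ rfl])
  rw [xSqClass_some_of_ne_zero _ hx0] at hne1 hneb
  obtain ⟨d, hdS, hd⟩ : ∃ d ∈ twoIsogenySelmerGroup (-21 * (a : ℕ)) (112 * (a : ℕ) ^ 2), sqClass (d : ℚ) = sqClass x := by
    have hmem := range_xSqClass_subset_image_twoIsogenySelmerGroup hab ⟨Affine.Point.some x y hg, rfl⟩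
    rw [Finset.coe_image, xSqClass_some_of_ne_zero _ hx0] at hmem
    obtain ⟨d, hd, hde⟩ := hmem
    exact ⟨d, hd, hde⟩
  have hd0 : (d : ℚ) ≠ 0 := by exact_mod_cast ne_zero_of_mem_twoIsogenySelmerGroup hdS
  have hdx : IsSquare ((d : ℚ) * x) := by
    obtain ⟨u, hu⟩ := (sqClass_eq_one_iff (mul_ne_zero hd0 hx0)).mp (by rw [sqClass_mul hd0 hx0, hd, Affine.SqUnits.mul_self])
    exact ⟨u, by rw [hu, pow_two]⟩
  have hd1 : d ≠ 1 := by
    rintro rfl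
    exact hne1 (by rw [← hd]; push_cast; simpa using sqClass_sq (1 : ℚ))
  have hd7 : d ≠ 7 := by
    rintro rfl
    apply hneb
    rw [← hd]
    have : ((112 * (a : ℕ) ^ 2 : ℤ) : ℚ) = 7 * (4 * (a : ℚ)) ^ 2 := by push_cast; ring
    rw [this, sqClass_mul (by norm_num) (pow_ne_zero _ (mul_ne_zero (by norm_num) ha0)), sqClass_sq, Affine.SqUnits.mul_one]
    norm_num
  have hmem := mem_of_mem_twoIsogenySelmerGroup_inertTwist ha.pos ha.squarefree hinert hdS
  simp only [Finset.mem_insert, Finset.mem_singleton] at hmem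
  rcases hmem with rfl | rfl | rfl | rfl
  · exact absurd rfl hd1
  · left; exact_mod_cast hdx
  · exact absurd rfl hd7
  · right; exact_mod_cast hdx

/-- **The same, read on a generator of the twist model `X₀(49)^{(−ℓ)}(ℚ)`** (`σ(ℓ) = −1`): if `g = (X, Y)` generates
`X₀(49)^{(−ℓ)}(ℚ)` modulo torsion (rank one), then `x = 4(X + 2ℓ)` — the abscissa of `C₀·g` on `E_{−ℓ}`, `C₀ = (½, −2ℓ, 0, 0)` — has
`2ℓ·x ∈ ℚ²` or `14ℓ·x ∈ ℚ²`. Stated for an arbitrary decidability instance on `ℚ` (the group law of the hypothesis `hgen`).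
[cite: SilvermanTate2015, §3.5–3.6] [cite: SilvermanAEC2009, Prop. X.4.9] -/
theorem isSquare_generator_quadraticTwist_negSplitPrime_of_symbol_neg [hdec : DecidableEq ℚ] (hl8 : l % 8 = 5)
    (hl7 : legendreSym l (-7) = 1) (hσ : ∀ s : ZMod l, s ^ 2 = -7 → ¬ IsSquare (2 * (s - 21)))
    [(cm7.quadraticTwist ((-l : ℤ) : ℚ)).IsElliptic] (hr : (cm7.quadraticTwist ((-l : ℤ) : ℚ)).mordellWeilRank = 1)
    {X Y : ℚ} (hXY : (cm7.quadraticTwist ((-l : ℤ) : ℚ)).toAffine.Nonsingular X Y)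
    (hgen : ∀ P : (cm7.quadraticTwist ((-l : ℤ) : ℚ)).toAffine.Point,
      ∃ (k : ℤ) (t : (cm7.quadraticTwist ((-l : ℤ) : ℚ)).toAffine.Point), IsOfFinAddOrder t ∧ P = k • Affine.Point.some X Y hXY + t) :
    IsSquare (2 * (l : ℚ) * (4 * (X + 2 * l))) ∨ IsSquare (14 * (l : ℚ) * (4 * (X + 2 * l))) := by
  have hE := smul_eq_twoTorsionModel_of_smul_eq_quadraticTwist (-(l : ℤ)) (cm7.quadraticTwist ((-l : ℤ) : ℚ)) 1 (one_smul _ _)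
  rw [mul_one] at hE
  set C₀ : VariableChange ℚ := ⟨(Units.mk0 (2 : ℚ) two_ne_zero)⁻¹, 2 * ((-(l : ℤ) : ℤ) : ℚ), 0, 0⟩ with hC₀
  haveI : (⟨0, ((21 * (-(l : ℤ)) : ℤ) : ℚ), 0, ((112 * (-(l : ℤ)) ^ 2 : ℤ) : ℚ), 0⟩ : WeierstrassCurve ℚ).IsElliptic := by
    rw [← hE]; infer_instance
  set e := (VariableChange.pointEquiv (cm7.quadraticTwist ((-l : ℤ) : ℚ)) C₀).trans (Affine.Point.congrEquiv hE) with he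
  have hrE : (⟨0, ((21 * (-(l : ℤ)) : ℤ) : ℚ), 0, ((112 * (-(l : ℤ)) ^ 2 : ℤ) : ℚ), 0⟩ : WeierstrassCurve ℚ).mordellWeilRank = 1 := by
    have h := mordellWeilRank_variableChange_holds (cm7.quadraticTwist ((-l : ℤ) : ℚ)) C₀
    unfold mordellWeilRank_variableChange at h
    rw [hE] at h; rw [h, hr]
  have hg' : (⟨0, ((21 * (-(l : ℤ)) : ℤ) : ℚ), 0, ((112 * (-(l : ℤ)) ^ 2 : ℤ) : ℚ), 0⟩ : WeierstrassCurve ℚ).toAffine.Nonsingular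
      (C₀.toX X) (C₀.toY X Y) := hE ▸ (VariableChange.nonsingular_iff _ C₀ X Y).mpr hXY
  have heg : e (.some X Y hXY) = .some (C₀.toX X) (C₀.toY X Y) hg' := by
    rw [he, AddEquiv.trans_apply, VariableChange.pointEquiv_some, Affine.Point.congrEquiv_some]
  have hx4 : C₀.toX X = 4 * (X + 2 * l) := by
    rw [VariableChange.toX_def, hC₀]; simp only [inv_inv, Units.val_mk0]; push_cast; ring
  rw [← hx4]
  refine isSquare_generator_negSplitPrime_of_symbol_neg hl8 hl7 hσ hrE hg' (of_decEq_indep (d₁ := hdec) (fun d : DecidableEq ℚ ↦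
    ∀ P : (⟨0, ((21 * (-(l : ℤ)) : ℤ) : ℚ), 0, ((112 * (-(l : ℤ)) ^ 2 : ℤ) : ℚ), 0⟩ : WeierstrassCurve ℚ).toAffine.Point,
      ∃ (k : ℤ) (t : (⟨0, ((21 * (-(l : ℤ)) : ℤ) : ℚ), 0, ((112 * (-(l : ℤ)) ^ 2 : ℤ) : ℚ), 0⟩ : WeierstrassCurve ℚ).toAffine.Point),
        IsOfFinAddOrder t ∧ P = k • Affine.Point.some _ _ hg' + t) _ fun P ↦ ?_)
  obtain ⟨k, tk, htk, hP⟩ := hgen (e.symm P)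
  refine ⟨k, e tk, e.toAddMonoidHom.isOfFinAddOrder htk, ?_⟩
  have := congrArg e hP
  rwa [AddEquiv.apply_symm_apply, map_add, map_zsmul, heg] at this

/-- **The same, read on a generator of `X₀(49)^{(−a)}(ℚ)`** (`a ≡ 1 (mod 4)` prime, inert in `ℚ(√−7)`, rank one): for a generator
`g′ = (X′, Y′)` modulo torsion, `x′ = 4(X′ + 2a)` has `2x′ ∈ ℚ²` or `14x′ ∈ ℚ²`. Arbitrary decidability instance on `ℚ`.
[cite: SilvermanTate2015, §3.5–3.6] [cite: SilvermanAEC2009, Prop. X.4.9] -/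
theorem isSquare_generator_quadraticTwist_negInertPrime [hdec : DecidableEq ℚ] {a : ℕ} (ha : a.Prime) (ha4 : a % 4 = 1)
    (ha7 : jacobiSym (-7) a = -1)
    [(cm7.quadraticTwist ((-a : ℤ) : ℚ)).IsElliptic] (hr : (cm7.quadraticTwist ((-a : ℤ) : ℚ)).mordellWeilRank = 1)
    {X Y : ℚ} (hXY : (cm7.quadraticTwist ((-a : ℤ) : ℚ)).toAffine.Nonsingular X Y)
    (hgen : ∀ P : (cm7.quadraticTwist ((-a : ℤ) : ℚ)).toAffine.Point,
      ∃ (k : ℤ) (t : (cm7.quadraticTwist ((-a : ℤ) : ℚ)).toAffine.Point), IsOfFinAddOrder t ∧ P = k • Affine.Point.some X Y hXY + t) :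
    IsSquare (2 * (4 * (X + 2 * a))) ∨ IsSquare (14 * (4 * (X + 2 * a))) := by
  have hE := smul_eq_twoTorsionModel_of_smul_eq_quadraticTwist (-(a : ℤ)) (cm7.quadraticTwist ((-a : ℤ) : ℚ)) 1 (one_smul _ _)
  rw [mul_one] at hE
  set C₀ : VariableChange ℚ := ⟨(Units.mk0 (2 : ℚ) two_ne_zero)⁻¹, 2 * ((-(a : ℤ) : ℤ) : ℚ), 0, 0⟩ with hC₀
  haveI : (⟨0, ((21 * (-(a : ℤ)) : ℤ) : ℚ), 0, ((112 * (-(a : ℤ)) ^ 2 : ℤ) : ℚ), 0⟩ : WeierstrassCurve ℚ).IsElliptic := by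
    rw [← hE]; infer_instance
  set e := (VariableChange.pointEquiv (cm7.quadraticTwist ((-a : ℤ) : ℚ)) C₀).trans (Affine.Point.congrEquiv hE) with he
  have hrE : (⟨0, ((21 * (-(a : ℤ)) : ℤ) : ℚ), 0, ((112 * (-(a : ℤ)) ^ 2 : ℤ) : ℚ), 0⟩ : WeierstrassCurve ℚ).mordellWeilRank = 1 := by
    have h := mordellWeilRank_variableChange_holds (cm7.quadraticTwist ((-a : ℤ) : ℚ)) C₀
    unfold mordellWeilRank_variableChange at h
    rw [hE] at h; rw [h, hr]
  have hg' : (⟨0, ((21 * (-(a : ℤ)) : ℤ) : ℚ), 0, ((112 * (-(a : ℤ)) ^ 2 : ℤ) : ℚ), 0⟩ : WeierstrassCurve ℚ).toAffine.Nonsingular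
      (C₀.toX X) (C₀.toY X Y) := hE ▸ (VariableChange.nonsingular_iff _ C₀ X Y).mpr hXY
  have heg : e (.some X Y hXY) = .some (C₀.toX X) (C₀.toY X Y) hg' := by
    rw [he, AddEquiv.trans_apply, VariableChange.pointEquiv_some, Affine.Point.congrEquiv_some]
  have hx4 : C₀.toX X = 4 * (X + 2 * a) := by
    rw [VariableChange.toX_def, hC₀]; simp only [inv_inv, Units.val_mk0]; push_cast; ring
  rw [← hx4]
  refine isSquare_generator_negInertPrime ha ha4 ha7 hrE hg' (of_decEq_indep (d₁ := hdec) (fun d : DecidableEq ℚ ↦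
    ∀ P : (⟨0, ((21 * (-(a : ℤ)) : ℤ) : ℚ), 0, ((112 * (-(a : ℤ)) ^ 2 : ℤ) : ℚ), 0⟩ : WeierstrassCurve ℚ).toAffine.Point,
      ∃ (k : ℤ) (t : (⟨0, ((21 * (-(a : ℤ)) : ℤ) : ℚ), 0, ((112 * (-(a : ℤ)) ^ 2 : ℤ) : ℚ), 0⟩ : WeierstrassCurve ℚ).toAffine.Point),
        IsOfFinAddOrder t ∧ P = k • Affine.Point.some _ _ hg' + t) _ fun P ↦ ?_)
  obtain ⟨k, tk, htk, hP⟩ := hgen (e.symm P)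
  refine ⟨k, e tk, e.toAddMonoidHom.isOfFinAddOrder htk, ?_⟩
  have := congrArg e hP
  rwa [AddEquiv.apply_symm_apply, map_add, map_zsmul, heg] at this

end Instances

/-! ## §2 Small inputs over `H = K[1]`: U2d at level `49`; `±7 ∉ K[1]²`; the point `(2, −1)` of `X₀(49)` -/

section Inputs

variable {K : Type} [Field K] [NumberField K]

/-- **U2d (`isSquare_prod_filter_ringClassGal`) at any level `M = 49`** (so at `M = N(X₀(49))` by `conductorNorm_cm7`).
[cite: Gross1984, §I.1] [cite: Lang1987, Ch. 12 §2 Thm. 5] -/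
theorem isSquare_prod_filter_ringClassGal_of_level_eq {M : ℕ} [NeZero M] (hM : M = 49)
    (hEta : x049_x_sub_two_eq_etaQuotient) (hD : deuring_etaQuotient49_heegner_generates_conjPrime)
    (hK : IsImaginaryQuadratic K) (hH : SatisfiesHeegnerHypothesis 49 K) (ι : K →+* ℂ)
    (Dt : ModularParametrizationData cm7 M) (hc : |Dt.c| = 1) [instG : Fintype ↥(ringClassGal ι 1)]
    (β : ℤ) (hβ : (4 * (M : ℤ)) ∣ β ^ 2 - NumberField.discr K) (x₁ : ringClassField K ι 1)
    (hx₁ : ∃ yc h, Dt.φ (heegnerPointOfConductor (NumberField.discr K) β 1) = .some (x₁ : ℂ) yc h)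
    (j : ringClassField K ι 1) (hj : j ^ 2 = -1) (τ₀ : ↥(ringClassGal ι 1))
    (w : ringClassField K ι 1) (hw0 : w ≠ 0) (hw2 : ((w : ℂ)) ^ 2 ∈ Set.range ι) (hτw : τ₀.1 w = -w) (hτj : τ₀.1 j = j) :
    IsSquare (∏ σ ∈ Finset.univ.filter (fun σ : ↥(ringClassGal ι 1) ↦ σ.1 j = -j), (σ.1 x₁ - 2)) := by
  subst hM
  exact isSquare_prod_filter_ringClassGal (instG := instG) hEta hD hK hH ι Dt hc β (by exact_mod_cast hβ) x₁ hx₁ j hj τ₀ w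
    hw0 hw2 hτw hτj

/-- `±7` are not squares in `K[1]` when `7 ∤ d_K` (`K[1]/K` unramified at `7`; tree `sqrt_intCast_not_mem_ringClassField`).
[cite: Cox2013, §9.A (ring class fields are unramified outside the conductor)] -/
theorem not_isSquare_seven_ringClassField (hK : IsImaginaryQuadratic K) (ι : K →+* ℂ) (h7 : ¬ (7 : ℤ) ∣ NumberField.discr K) :
    ¬ IsSquare (7 : ringClassField K ι 1) ∧ ¬ IsSquare (-7 : ringClassField K ι 1) := by
  have key : ∀ d : ℤ, (7 : ℤ) ∣ d → ¬ (7 : ℤ) ^ 2 ∣ d → ¬ IsSquare ((d : ringClassField K ι 1)) := by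
    rintro d hd hd2 ⟨w, hw⟩
    refine sqrt_intCast_not_mem_ringClassField hK ι one_ne_zero (by norm_num : (7 : ℕ).Prime) (by exact_mod_cast hd)
      (by exact_mod_cast hd2) (by norm_num) (by exact_mod_cast h7) (w : ℂ) ?_ w.2
    have := congrArg (fun z : ringClassField K ι 1 ↦ (z : ℂ)) hw
    push_cast at this
    rw [this]; ring
  exact ⟨by simpa using key 7 ⟨1, by norm_num⟩ (by norm_num), by simpa using key (-7) ⟨-1, by norm_num⟩ (by norm_num)⟩

/-- On `X₀(49)` over any field: a point with `x = 2` is `(2, −1)` (`(y + 1)² = 0`), and `2·(2, −1) = O`. [folklore] -/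
theorem eq_neg_one_of_nonsingular_two {F : Type*} [Field F] [CharZero F] {yv : F} (h : (cm7.baseChange F).toAffine.Nonsingular 2 yv) :
    yv = -1 := by
  have he := h.1
  rw [Affine.equation_iff'] at he
  simp only [baseChange, map_a₁, map_a₂, map_a₃, map_a₄, map_a₆] at he
  norm_num at he
  have : (yv + 1) ^ 2 = 0 := by linear_combination he
  linear_combination (pow_eq_zero_iff two_ne_zero).mp this

end Inputs

section TwoTorsion

/-- On `X₀(49)` (char. `0`): an affine point with `x = 2` is `(2, −1)` and has order `2` (`−(2,−1) = (2, −2a₁ − a₃ + 1) = (2,−1)`). [folklore] -/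
theorem isOfFinAddOrder_some_of_eq_two {F : Type*} [Field F] [CharZero F] {xv yv : F}
    (h : (cm7.baseChange F).toAffine.Nonsingular xv yv) (hx : xv = 2) : IsOfFinAddOrder (Affine.Point.some xv yv h) := by
  subst hx
  have hy : yv = -1 := eq_neg_one_of_nonsingular_two h
  subst hy
  have hneg : -(Affine.Point.some 2 (-1) h : (cm7.baseChange F).toAffine.Point) = Affine.Point.some 2 (-1) h := by
    rw [Affine.Point.neg_some]; congr 1; simp [Affine.negY, baseChange]; norm_num
  refine (isOfFinAddOrder_iff_nsmul_eq_zero).mpr ⟨2, two_pos, ?_⟩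
  rw [two_nsmul, add_eq_zero_iff_eq_neg, hneg]

end TwoTorsion

/-! ## §3 Torsion and index bookkeeping along `ι` and `Φ_u` (arbitrary decidability instance on `ℚ` in the statements; the
proofs move to the classical world of the tree's point-group lemmas) -/

section InclTorsion

/-- Finite order is reflected along `Q ↦ Φ_u(ι Q)` (`ι` injective, `Φ_u` an isomorphism). [folklore] -/
theorem isOfFinAddOrder_of_twistPointEquivOver_incl {F : Type} [Field F] [CharZero F] [hdQ : DecidableEq ℚ] {c : ℚ} {u : F}
    (huQ : u ∉ Set.range (algebraMap ℚ F)) (huc : u ^ 2 = algebraMap ℚ F c) (Q : (cm7.quadraticTwist c).toAffine.Point)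
    (h : IsOfFinAddOrder (twistPointEquivOver cm7 huQ huc (QuadraticDescent.incl F (cm7.quadraticTwist c) Q))) :
    IsOfFinAddOrder Q := by
  obtain rfl : hdQ = fun a b ↦ Classical.propDecidable (a = b) := Subsingleton.elim _ _
  letI : DecidableEq ℚ := fun a b ↦ Classical.propDecidable (a = b)
  have h1 := (twistPointEquivOver cm7 huQ huc).symm.toAddMonoidHom.isOfFinAddOrder h
  rw [AddEquiv.coe_toAddMonoidHom, AddEquiv.symm_apply_apply] at h1
  exact ((QuadraticDescent.incl_injective (K := F) (cm7.quadraticTwist c)).isOfFinAddOrder_iff).mp h1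

/-- `Φ_u ∘ ι` is additive: `Φ_u(ι(k·g + t)) = k·Φ_u(ι g) + Φ_u(ι t)` (the right side in the classical instance world of the two group
homomorphisms, the left for any instance on `ℚ` — it rewrites relations produced by the Mordell–Weil lemmas). [folklore] -/
theorem twistPointEquivOver_incl_zsmul_add {F : Type} [Field F] [CharZero F] [hdQ : DecidableEq ℚ] {c : ℚ} {u : F}
    (huQ : u ∉ Set.range (algebraMap ℚ F)) (huc : u ^ 2 = algebraMap ℚ F c) (k : ℤ) (g t : (cm7.quadraticTwist c).toAffine.Point) :
    twistPointEquivOver cm7 huQ huc (QuadraticDescent.incl F (cm7.quadraticTwist c) (k • g + t)) =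
      k • twistPointEquivOver cm7 huQ huc (QuadraticDescent.incl F (cm7.quadraticTwist c) g) +
        twistPointEquivOver cm7 huQ huc (QuadraticDescent.incl F (cm7.quadraticTwist c) t) := by
  obtain rfl : hdQ = fun a b ↦ Classical.propDecidable (a = b) := Subsingleton.elim _ _
  letI : DecidableEq ℚ := fun a b ↦ Classical.propDecidable (a = b)
  rw [map_add, map_zsmul, map_add, map_zsmul]

/-- Rank-one bookkeeping (any decidability instance on `ℚ`; proof in the classical world of the tree's Mordell–Weil lemmas): for `V/ℚ`
with `#V(ℚ)_tors = 2`, a generator `g` modulo torsion (`exists_generator_of_mordellWeilRank_eq_one`) and a point `z` of infinite order,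
`z = N₀·g + t₀` with `N₀ ≠ 0`, `t₀` torsion and `[V(ℚ) : ℤz] = 2|N₀|` (`KrizLi2019.index_zmultiples_eq`). [cite: SilvermanAEC2009, VIII.6] -/
theorem exists_eq_zsmul_generator_add_and_index [hdQ : DecidableEq ℚ] {V : WeierstrassCurve ℚ} [V.IsElliptic]
    (htors : V.torsionOrder = 2) {g z : V.toAffine.Point} (hg : ¬ IsOfFinAddOrder g)
    (hgen : ∀ P : V.toAffine.Point, ∃ (k : ℤ) (t : V.toAffine.Point), IsOfFinAddOrder t ∧ P = k • g + t)
    (hz : ¬ IsOfFinAddOrder z) :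
    g ≠ 0 ∧ ∃ (N₀ : ℤ) (t₀ : V.toAffine.Point), N₀ ≠ 0 ∧ IsOfFinAddOrder t₀ ∧ z = N₀ • g + t₀ ∧
      (AddSubgroup.zmultiples z).index = N₀.natAbs * 2 := by
  obtain rfl : hdQ = fun a b ↦ Classical.propDecidable (a = b) := Subsingleton.elim _ _
  letI : DecidableEq ℚ := fun a b ↦ Classical.propDecidable (a = b)
  obtain ⟨N₀, t₀, ht₀, hzN⟩ := hgen z
  have hN0 : N₀ ≠ 0 := by
    rintro rfl
    rw [zero_zsmul, zero_add] at hzN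
    exact hz (hzN ▸ ht₀)
  have hgen2 : ∀ y : V.toAffine.Point, ∃ m : ℤ, y - m • g ∈ AddCommGroup.torsion V.toAffine.Point := fun y ↦ by
    obtain ⟨m, tm, htm, hym⟩ := hgen y
    exact ⟨m, (AddCommGroup.mem_torsion _).mpr (by rw [hym, add_sub_cancel_left]; exact htm)⟩
  have hzt : z - N₀ • g ∈ AddCommGroup.torsion V.toAffine.Point :=
    (AddCommGroup.mem_torsion _).mpr (by rw [hzN, add_sub_cancel_left]; exact ht₀)
  refine ⟨fun h0 ↦ hg (h0 ▸ IsOfFinAddOrder.zero), N₀, t₀, hN0, ht₀, hzN, ?_⟩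
  rw [KrizLi2019.index_zmultiples_eq V hg hgen2 hN0 hzt, htors]

end InclTorsion

end Summit.BirchSwinnertonDyer.BirchSwinnertonDyer.Theorems.GoldfeldGoodTwists

end
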